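import Summits.ValiantsHypothesis.ValiantsHypothesis.Theorems.BarrierLeverPartitionMinorsMooreBenchRows

/-!
# Route BarrierLever — item 20172 (CPM), benchmark row 14: reduction of `MCBenchPairsAt h` to the
# linear independence of the stage-1 peel family (Γ-reduction + generic nodes)

Helper file (`--supports stmt-ValiantsHypothesis-20172`; cell valiant-natproofs, rung V4, 𝒟-side of
door (c), benchmark «row 14», duty (iv); seat valiant-natproofs-prover gen 14).  Closes NO item;
definition-free.

* `det_benchmark_eq_det_thetaHat` — the Γ-reduction of val-np-p2 (`ChowCube.det_xPrivate_eq_det_thetaHat`)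
  for the x-private Moore–Chow design with SYMBOLIC nodes `q a c = (X a)^(2^c)` over
  `A = MvPolynomial (Fin h) ℂ`: `det[coeff_{E (u i) (benchCols j)} ∏_a (x_a + A_a)] = det Θ̂[u, benchCols]`.
* **`mcBenchPairsAt_of_linearIndependent`** — if the stage-1 family
  `(rowVec (c_{h+1}) (nodeY h) x)_{x ∈ stageRows 1 h}` is linearly independent over `A`, then
  `MCBenchPairsAt h`: any injective enumeration `u` of the sets of size `≤ 2` has `r = c_{h+1}`
  (`card_filter_card_le_two`); the rows of `Θ̂` are `±` the stage-1 rows (`…MooreBenchRows`), so they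
  are independent and `det Θ̂ ≠ 0` in the domain `A`; hence the symbolic benchmark determinant is a
  nonzero polynomial in the nodes and some complex node table is a non-root (`MvPolynomial.funext`).

WHAT THIS IS NOT: the peel itself (files `…MooreBenchStage/Lead/Peel`); nothing on items 20172 / 20195
/ 19717, crux stmt-ValiantsHypothesis-14610, or `VP` versus `VNP`.
-/

set_option linter.dupNamespace false

namespace Summit.ValiantsHypothesis.ValiantsHypothesis.Theorems.BarrierLever.MoorePeel

open MvPolynomial Finset
open Summit.ValiantsHypothesis.ValiantsHypothesis.Theorems.BarrierLever.ChowCube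
  (det_xPrivate_eq_det_thetaHat)

section Reduction

variable {h : ℕ}

/-- **The Γ-reduction for the Moore–Chow design with symbolic nodes.**  For any rows `u` and the
benchmark columns (`r ≤ 2^h`), the partition-minor determinant of `∏_a (x_a + 1 + Σ_c (X a)^(2^c) y_c)`
over `A = MvPolynomial (Fin h) ℂ` equals `det Θ̂[u, benchCols]`. -/
theorem det_benchmark_eq_det_thetaHat {r : ℕ} (hr : r ≤ 2 ^ h) (u : Fin r → Finset (Fin h)) :
    (Matrix.of fun i j : Fin r => coeff
        (∑ a ∈ u i, Finsupp.single (Fin.castAdd h a) 1 +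
          ∑ c ∈ benchCols h r j, Finsupp.single (Fin.natAdd h c) 1)
        (∏ a : Fin h, (X (Fin.castAdd h a) + (1 + ∑ c : Fin h,
          C ((X a : MvPolynomial (Fin h) ℂ) ^ 2 ^ (c : ℕ)) * X (Fin.natAdd h c))) :
            MvPolynomial (Fin (h + h)) (MvPolynomial (Fin h) ℂ))).det =
    (Matrix.of fun i j : Fin r => coeff
        (∑ a ∈ (∅ : Finset (Fin h)), Finsupp.single (Fin.castAdd h a) 1 +
          ∑ c ∈ benchCols h r j, Finsupp.single (Fin.natAdd h c) 1)
        (∏ a ∈ u i, ∑ S ∈ (Finset.univ : Finset (Fin h)).powerset,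
          monomial (∑ a' ∈ (∅ : Finset (Fin h)), Finsupp.single (Fin.castAdd h a') 1 +
            ∑ c ∈ S, Finsupp.single (Fin.natAdd h c) 1)
            ((-1 : MvPolynomial (Fin h) ℂ) ^ S.card * (S.card.factorial : MvPolynomial (Fin h) ℂ) *
              ∏ c ∈ S, (X a : MvPolynomial (Fin h) ℂ) ^ 2 ^ (c : ℕ)) :
                MvPolynomial (Fin (h + h)) (MvPolynomial (Fin h) ℂ))).det :=
  det_xPrivate_eq_det_thetaHat (fun a c => (X a : MvPolynomial (Fin h) ℂ) ^ 2 ^ (c : ℕ)) u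
    (benchCols h r) (benchCols_injective hr) (fun j S hS => benchCols_downClosed hr j S hS)

/-- Sets of size `≤ 2`: empty, a singleton, or an ordered pair. -/
theorem eq_empty_or_singleton_or_pair (S : Finset (Fin h)) (hS : S.card ≤ 2) :
    S = ∅ ∨ (∃ b, S = {b}) ∨ (∃ b b' : Fin h, b < b' ∧ S = {b, b'}) := by
  by_cases h0 : S.card = 0
  · exact Or.inl (Finset.card_eq_zero.mp h0)
  by_cases h1 : S.card = 1
  · exact Or.inr (Or.inl (Finset.card_eq_one.mp h1))
  · have h2 : S.card = 2 := by omega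
    obtain ⟨x, y, hxy, rfl⟩ := Finset.card_eq_two.mp h2
    rcases lt_or_gt_of_ne hxy with hlt | hgt
    · exact Or.inr (Or.inr ⟨x, y, hlt, rfl⟩)
    · exact Or.inr (Or.inr ⟨y, x, hgt, Finset.pair_comm x y⟩)

/-- The number of subsets of `Fin h` of size `≤ 2` is `c_{h+1} = 1 + h + C(h,2)`. -/
theorem card_filter_card_le_two (h : ℕ) :
    ((Finset.univ : Finset (Finset (Fin h))).filter fun S => S.card ≤ 2).card =
      windowStart (h + 1) := by
  classical
  have e : ((Finset.univ : Finset (Finset (Fin h))).filter fun S => S.card ≤ 2) =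
      (Finset.range 3).biUnion fun k => Finset.powersetCard k (Finset.univ : Finset (Fin h)) := by
    ext S
    simp only [Finset.mem_filter, Finset.mem_univ, true_and, Finset.mem_biUnion, Finset.mem_range,
      Finset.mem_powersetCard, Finset.subset_univ]
    constructor
    · intro hS
      exact ⟨S.card, by omega, rfl⟩
    · rintro ⟨k, hk, hSk⟩
      omega
  rw [e, Finset.card_biUnion]
  · simp only [Finset.card_powersetCard, Finset.card_univ, Fintype.card_fin]
    rw [windowStart_succ_eq_choose]
    simp [Finset.sum_range_succ, Nat.choose_zero_right, Nat.choose_one_right]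
  · intro k _ k' _ hkk'
    rw [Function.onFun, Finset.disjoint_left]
    intro S hS hS'
    rw [Finset.mem_powersetCard] at hS hS'
    exact hkk' (hS.2.symm.trans hS'.2)

/-- **Reduction of the benchmark to the stage-1 peel family.**  If the stage-1 rows
`(rowVec (c_{h+1}) (nodeY h) x)_{x ∈ stageRows 1 h}` — i.e. the unsigned rows `∅`, `{b}`, `{b,b'}` of
`Θ̂` for the symbolic Moore–Chow design — are linearly independent over `MvPolynomial (Fin h) ℂ`,
then `MCBenchPairsAt h`. -/
theorem mcBenchPairsAt_of_linearIndependent (h : ℕ)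
    (hLI : LinearIndependent (MvPolynomial (Fin h) ℂ)
      (fun x : ↥(stageRows 1 h) => rowVec (windowStart (h + 1)) (nodeY h) (x : RowLabel))) :
    MCBenchPairsAt h := by
  classical
  intro r u hu hcard hsurj
  -- (i) `r = c_{h+1}`
  have hr : r = windowStart (h + 1) := by
    have himg : Finset.univ.image u =
        (Finset.univ : Finset (Finset (Fin h))).filter fun S => S.card ≤ 2 := by
      ext S
      simp only [Finset.mem_image, Finset.mem_univ, true_and, Finset.mem_filter]
      constructor
      · rintro ⟨i, rfl⟩
        exact hcard i
      · intro hS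
        obtain ⟨i, hi⟩ := hsurj S hS
        exact ⟨i, hi⟩
    have := congrArg Finset.card himg
    rwa [Finset.card_image_of_injective _ hu, Finset.card_univ, Fintype.card_fin,
      card_filter_card_le_two] at this
  subst hr
  have hr2 : windowStart (h + 1) ≤ 2 ^ h := windowStart_succ_le_two_pow h
  -- (ii) labels of the rows (an opaque labelling with its three defining equations)
  obtain ⟨lab, lab_empty, lab_single, lab_pair⟩ : ∃ lab : Finset (Fin h) → RowLabel,
      lab ∅ = Sum.inl 0 ∧ (∀ b : Fin h, lab {b} = Sum.inr (Sum.inl (0, (b : ℕ)))) ∧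
      (∀ b b' : Fin h, b < b' → lab {b, b'} = Sum.inr (Sum.inr ((b : ℕ), (b' : ℕ)))) := by
    refine ⟨fun S => if hS : S.Nonempty then
      (if S.card = 1 then Sum.inr (Sum.inl (0, ((S.min' hS : Fin h) : ℕ)))
       else Sum.inr (Sum.inr (((S.min' hS : Fin h) : ℕ), ((S.max' hS : Fin h) : ℕ))))
      else Sum.inl 0, by simp, fun b => by simp, fun b b' hlt => ?_⟩
    have hne : ({b, b'} : Finset (Fin h)).Nonempty := ⟨b, by simp⟩
    have hc : ({b, b'} : Finset (Fin h)).card ≠ 1 := by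
      rw [Finset.card_pair (ne_of_lt hlt)]
      norm_num
    have hmin : ({b, b'} : Finset (Fin h)).min' hne = b :=
      le_antisymm (Finset.min'_le _ _ (by simp))
        (Finset.le_min' _ _ _ fun y hy => by
          rcases Finset.mem_insert.mp hy with rfl | hy
          · exact le_rfl
          · rw [Finset.mem_singleton.mp hy]; exact le_of_lt hlt)
    have hmax : ({b, b'} : Finset (Fin h)).max' hne = b' :=
      le_antisymm
        (Finset.max'_le _ _ _ fun y hy => by
          rcases Finset.mem_insert.mp hy with rfl | hy
          · exact le_of_lt hlt
          · rw [Finset.mem_singleton.mp hy])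
        (Finset.le_max' _ _ (by simp))
    simp only [hne, dif_pos, hc, if_false, hmin, hmax]
  -- (iii) the row identity `Θ̂[u i, T_j] = (-1)^{|T_j|} · rowVec (lab (u i)) j`
  have hrow : ∀ i j, coeff
      (∑ a ∈ (∅ : Finset (Fin h)), Finsupp.single (Fin.castAdd h a) 1 +
        ∑ c ∈ benchCols h (windowStart (h + 1)) j, Finsupp.single (Fin.natAdd h c) 1)
      (∏ a ∈ u i, ∑ S ∈ (Finset.univ : Finset (Fin h)).powerset,
        monomial (∑ a' ∈ (∅ : Finset (Fin h)), Finsupp.single (Fin.castAdd h a') 1 +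
          ∑ c ∈ S, Finsupp.single (Fin.natAdd h c) 1)
          ((-1 : MvPolynomial (Fin h) ℂ) ^ S.card * (S.card.factorial : MvPolynomial (Fin h) ℂ) *
            ∏ c ∈ S, (X a : MvPolynomial (Fin h) ℂ) ^ 2 ^ (c : ℕ)) :
              MvPolynomial (Fin (h + h)) (MvPolynomial (Fin h) ℂ)) =
      (-1 : MvPolynomial (Fin h) ℂ) ^ (benchCols h (windowStart (h + 1)) j).card *
        rowVec (windowStart (h + 1)) (nodeY h) (lab (u i)) j := by
    intro i j
    rcases eq_empty_or_singleton_or_pair (u i) (hcard i) with h0 | ⟨b, hb⟩ | ⟨b, b', hlt, hbb⟩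
    · rw [h0, lab_empty]
      exact thetaHat_empty_eq_rowVec hr2 j
    · rw [hb, lab_single]
      exact thetaHat_singleton_eq_rowVec hr2 b j
    · rw [hbb, lab_pair b b' hlt]
      exact thetaHat_pair_eq_rowVec hr2 b b' (ne_of_lt hlt) j
  -- (iv) the labels are alive at stage 1 and pairwise distinct
  have hmem : ∀ i, lab (u i) ∈ stageRows 1 h := by
    intro i
    rcases eq_empty_or_singleton_or_pair (u i) (hcard i) with h0 | ⟨b, hb⟩ | ⟨b, b', hlt, hbb⟩
    · rw [h0, lab_empty, inl_mem_stageRows, windowStart_one]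
      exact Nat.one_pos
    · rw [hb, lab_single, inr_inl_mem_stageRows]
      exact ⟨Nat.one_pos, b.2⟩
    · rw [hbb, lab_pair b b' hlt, inr_inr_mem_stageRows]
      exact ⟨hlt, b'.2⟩
  have hinj : Function.Injective fun i => (⟨lab (u i), hmem i⟩ : ↥(stageRows 1 h)) := by
    intro i i' e
    have e' : lab (u i) = lab (u i') := congrArg Subtype.val e
    apply hu
    rcases eq_empty_or_singleton_or_pair (u i) (hcard i) with h0 | ⟨b, hb⟩ | ⟨b, b', hlt, hbb⟩ <;>
      rcases eq_empty_or_singleton_or_pair (u i') (hcard i') with h0' | ⟨c, hc⟩ | ⟨c, c', hlt', hcc⟩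
    · rw [h0, h0']
    · rw [h0, lab_empty, hc, lab_single] at e'
      exact absurd e' (by simp)
    · rw [h0, lab_empty, hcc, lab_pair c c' hlt'] at e'
      exact absurd e' (by simp)
    · rw [hb, lab_single, h0', lab_empty] at e'
      exact absurd e' (by simp)
    · rw [hb, lab_single, hc, lab_single] at e'
      rw [hb, hc]
      simp only [Sum.inr.injEq, Sum.inl.injEq, Prod.mk.injEq, true_and] at e'
      rw [Fin.ext e']
    · rw [hb, lab_single, hcc, lab_pair c c' hlt'] at e'
      exact absurd e' (by simp)
    · rw [hbb, lab_pair b b' hlt, h0', lab_empty] at e'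
      exact absurd e' (by simp)
    · rw [hbb, lab_pair b b' hlt, hc, lab_single] at e'
      exact absurd e' (by simp)
    · rw [hbb, lab_pair b b' hlt, hcc, lab_pair c c' hlt'] at e'
      rw [hbb, hcc]
      simp only [Sum.inr.injEq, Prod.mk.injEq] at e'
      rw [Fin.ext e'.1, Fin.ext e'.2]
  -- (v) the unsigned rows are independent, hence so are the rows of `Θ̂`
  have hLI' : LinearIndependent (MvPolynomial (Fin h) ℂ)
      (fun i => rowVec (windowStart (h + 1)) (nodeY h) (lab (u i))) :=
    hLI.comp (fun i => (⟨lab (u i), hmem i⟩ : ↥(stageRows 1 h))) hinj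
  set Θ : Matrix (Fin (windowStart (h + 1))) (Fin (windowStart (h + 1))) (MvPolynomial (Fin h) ℂ) :=
    Matrix.of fun i j => coeff
      (∑ a ∈ (∅ : Finset (Fin h)), Finsupp.single (Fin.castAdd h a) 1 +
        ∑ c ∈ benchCols h (windowStart (h + 1)) j, Finsupp.single (Fin.natAdd h c) 1)
      (∏ a ∈ u i, ∑ S ∈ (Finset.univ : Finset (Fin h)).powerset,
        monomial (∑ a' ∈ (∅ : Finset (Fin h)), Finsupp.single (Fin.castAdd h a') 1 +
          ∑ c ∈ S, Finsupp.single (Fin.natAdd h c) 1)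
          ((-1 : MvPolynomial (Fin h) ℂ) ^ S.card * (S.card.factorial : MvPolynomial (Fin h) ℂ) *
            ∏ c ∈ S, (X a : MvPolynomial (Fin h) ℂ) ^ 2 ^ (c : ℕ)) :
              MvPolynomial (Fin (h + h)) (MvPolynomial (Fin h) ℂ)) with hΘ
  have hΘrows : LinearIndependent (MvPolynomial (Fin h) ℂ) (fun i => Θ i) := by
    rw [Fintype.linearIndependent_iff] at hLI' ⊢
    intro g hg
    refine hLI' g ?_
    funext j
    have hj := congrArg (fun f : Fin (windowStart (h + 1)) → MvPolynomial (Fin h) ℂ => f j) hg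
    simp only [Finset.sum_apply, Pi.smul_apply, smul_eq_mul, Pi.zero_apply, hΘ, Matrix.of_apply,
      hrow] at hj ⊢
    have e : ∑ i, g i * ((-1 : MvPolynomial (Fin h) ℂ) ^
        (benchCols h (windowStart (h + 1)) j).card *
          rowVec (windowStart (h + 1)) (nodeY h) (lab (u i)) j) =
        (-1 : MvPolynomial (Fin h) ℂ) ^ (benchCols h (windowStart (h + 1)) j).card *
          ∑ i, g i * rowVec (windowStart (h + 1)) (nodeY h) (lab (u i)) j := by
      rw [Finset.mul_sum]
      exact Finset.sum_congr rfl fun i _ => by ring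
    rw [e] at hj
    have hunit : IsUnit ((-1 : MvPolynomial (Fin h) ℂ) ^
        (benchCols h (windowStart (h + 1)) j).card) := (isUnit_one.neg).pow _
    exact (hunit.mul_right_eq_zero).mp hj
  have hdetΘ : Θ.det ≠ 0 := det_ne_zero_of_linearIndependent_rows' Θ hΘrows
  -- (vi) the symbolic benchmark determinant is nonzero
  have hdet := det_benchmark_eq_det_thetaHat hr2 u
  rw [← hΘ] at hdet
  set P : MvPolynomial (Fin (h + h)) (MvPolynomial (Fin h) ℂ) :=
    ∏ a : Fin h, (X (Fin.castAdd h a) + (1 + ∑ c : Fin h,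
      C ((X a : MvPolynomial (Fin h) ℂ) ^ 2 ^ (c : ℕ)) * X (Fin.natAdd h c))) with hP
  set B : Matrix (Fin (windowStart (h + 1))) (Fin (windowStart (h + 1))) (MvPolynomial (Fin h) ℂ) :=
    Matrix.of fun i j => coeff
      (∑ a ∈ u i, Finsupp.single (Fin.castAdd h a) 1 +
        ∑ c ∈ benchCols h (windowStart (h + 1)) j, Finsupp.single (Fin.natAdd h c) 1) P with hB
  have hBdet : B.det ≠ 0 := by rw [hdet]; exact hdetΘ
  -- (vii) a complex node table off the zero set
  obtain ⟨Y, hY⟩ : ∃ Y : Fin h → ℂ, eval Y B.det ≠ 0 := by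
    by_contra hall
    push Not at hall
    exact hBdet (MvPolynomial.funext fun Y => by rw [hall Y, map_zero])
  refine ⟨Y, ?_⟩
  -- (viii) evaluation of the symbolic matrix is the benchmark matrix
  have hmapP : MvPolynomial.map (eval Y) P = ∏ a : Fin h, mooreChowFactor h Y a := by
    rw [hP, map_prod]
    refine Finset.prod_congr rfl fun a _ => ?_
    rw [mooreChowFactor, map_add, map_add, map_X, map_one, map_sum, add_assoc]
    congr 2
    refine Finset.sum_congr rfl fun c _ => ?_
    rw [map_mul, map_C, map_X, map_pow, eval_X]
  rw [RingHom.map_det] at hY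
  have hmat : (eval Y).mapMatrix B = Matrix.of fun i j : Fin (windowStart (h + 1)) => coeff
      (∑ a ∈ u i, Finsupp.single (Fin.castAdd h a) 1 +
        ∑ c ∈ benchCols h (windowStart (h + 1)) j, Finsupp.single (Fin.natAdd h c) 1)
      (∏ a : Fin h, mooreChowFactor h Y a) := by
    ext i j
    rw [RingHom.mapMatrix_apply, Matrix.map_apply, hB, Matrix.of_apply, Matrix.of_apply,
      ← hmapP, coeff_map]
  rw [hmat] at hY
  exact hY

end Reduction

end Summit.ValiantsHypothesis.ValiantsHypothesis.Theorems.BarrierLever.MoorePeel
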